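import Mathlib.Data.Finset.Lattice.Fold
import Mathlib.Data.Finset.Prod
import Mathlib.Data.Finset.Card
import Mathlib.Data.Fintype.Pi
import Mathlib.Order.Lattice.Nat
import Mathlib.Data.Fintype.Prod
import Mathlib.Computability.Language
import HarnessLib

/-!
# Graph complexity: intersection (star) complexity of bipartite graphs (Pudlák–Rödl–Savický)

The *discrete complexity* framework of Pudlák–Rödl–Savický (1988) and Cavalar–Oliveira (2025):
a ground set, a family `𝓖` of *generators* (subsets of the ground set), and the least number of
set operations needed to build a target set `A` from the generators by pairwise unions and
intersections. This file formalises the **intersection complexity** `D_∩(A ∣ 𝓖)` — the least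
number of *intersections*, unions being free (Cavalar–Oliveira 2025, §2.1) — and its main instance,
the **star (graph) complexity** of a bipartite graph `G ⊆ X × Y` with respect to the family
`𝒢_{X,Y}` of row stars `{x} × Y` and column stars `X × {y}` (Pudlák–Rödl–Savický 1988, §1;
Cavalar–Oliveira 2025, §2.2.2; Jukna 2012, §1.7).

## The pool model (free-union normal form)

Since unions cost nothing, a generating sequence with `d` intersections is the same thing as a
sequence of `d` *intersection steps*, each adding to the current *pool* of available sets the set
`A ∩ B` for two sets `A`, `B` that are unions of pool members (`FreeOver`); the target must finally
be a union of pool members. (`→`: every member of a Cavalar–Oliveira sequence is a union of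
generators and earlier intersection results, by induction; `←`: realise each union by free union
steps.) We take this normal form as the DEFINITION (`Reach`, `InterDerivable`, `interCplx`): it is
literally recursive in `d`, which is what restriction and simulation arguments need.

Deviation, documented: the EMPTY union is allowed (`FreeOver 𝓕 ∅` always holds), i.e. `∅` is a free
set. By Cavalar–Oliveira 2025, Fact 8 (`D_∩(A ∣ 𝓑) = D_∩(A ∣ 𝓑 ∪ {∅})` for `A ≠ ∅`) this changes
nothing for non-empty targets; for `A = ∅` our value is `0`.

## Contents

* `FreeOver`, `Reach`, `InterDerivable`, `interCplx` and their API (monotonicity, padding,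
  attainment of the infimum);
* `rowStar`, `colStar`, `stars`, `starCplx` (= `D_∩(G ∣ 𝒢_{X,Y})`), the trivial bound
  `starCplx X Y G ≤ #G` (so the infimum is attained for every `G ⊆ X ×ˢ Y`);
* `IsBipRamsey X Y K G` — `G` has no monochromatic `K × K` combinatorial rectangle (both colours);
* `bipSlice L n` — the `2n`-th slice of a language `L ⊆ {0,1}*` read as a bipartite graph on
  `{0,1}ⁿ × {0,1}ⁿ` (the graphs `G` with `f_G` = a slice of `L`, Cavalar–Oliveira 2025, §2.4).

The transference to Boolean circuits (Cavalar–Oliveira 2025, Lemma 13; Pudlák–Rödl–Savický 1988)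
is in `GraphComplexityTransfer.lean`. NOT here: the full discrete complexity `D(A ∣ 𝓖)` counting
unions too, cover complexity `ρ` (semi-filters, Cavalar–Oliveira §3), cyclic constructions.

## References

* P. Pudlák, V. Rödl, P. Savický, *Graph complexity*, Acta Inform. 25 (1988) 515–535, §1–2
  [PudlakRodlSavicky1988].
* B. Cavalar, I. Oliveira, *Boolean circuit complexity and two-dimensional cover problems*,
  ACM ToCT 17(2) (2025), arXiv:2503.14117, §2.1–2.4 [CavalarOliveira2025].
* S. Jukna, *Boolean Function Complexity* (2012), §1.7 [Jukna2012].

Mathlib has nothing on graph/star complexity (searched `star complexity`, `graph complexity`,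
`Ramsey` ∧ `bipartite`: only `SimpleGraph` colourings / `Finset` Ramsey-type lemmas unrelated to
this measure); we use `Finset`, `Finset.sup`, `Finset.product`, `Nat.sInf`.
-/

namespace Literature.Computability.Complexity.GraphComplexity

/-! ### Discrete intersection complexity: the pool model -/

section Discrete

variable {γ : Type*} [DecidableEq γ]

/-- `FreeOver 𝓕 A`: the set `A` is a union of finitely many members of the pool `𝓕` — it is
available at no cost when only intersections are counted (the empty union `A = ∅` included).
(Cavalar–Oliveira 2025, §2.1, `D_∩`; Pudlák–Rödl–Savický 1988, §1.) [cite: CavalarOliveira2025, §2.1] -/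
def FreeOver (𝓕 : Set (Finset γ)) (A : Finset γ) : Prop :=
  ∃ 𝒪 : Finset (Finset γ), (↑𝒪 : Set (Finset γ)) ⊆ 𝓕 ∧ 𝒪.sup id = A

/-- `Reach d 𝓖 𝓕`: the pool `𝓕` arises from the pool `𝓖` by exactly `d` intersection steps, each
adding `A ∩ B` for two sets `A`, `B` free over the current pool (free-union normal form of a
generating sequence with `d` intersections; Cavalar–Oliveira 2025, §2.1). [cite: CavalarOliveira2025, §2.1] -/
def Reach : ℕ → Set (Finset γ) → Set (Finset γ) → Prop
  | 0, 𝓖, 𝓕 => 𝓕 = 𝓖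
  | d + 1, 𝓖, 𝓕 => ∃ A B : Finset γ, FreeOver 𝓖 A ∧ FreeOver 𝓖 B ∧ Reach d (insert (A ∩ B) 𝓖) 𝓕

/-- `InterDerivable 𝓖 d A`: `A` can be generated from the generators `𝓖` with (exactly, hence by
padding at most) `d` intersections and any number of unions, i.e. `D_∩(A ∣ 𝓖) ≤ d`
(Cavalar–Oliveira 2025, §2.1). [cite: CavalarOliveira2025, §2.1] -/
def InterDerivable (𝓖 : Set (Finset γ)) (d : ℕ) (A : Finset γ) : Prop :=
  ∃ 𝓕 : Set (Finset γ), Reach d 𝓖 𝓕 ∧ FreeOver 𝓕 A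

/-- The **intersection complexity** `D_∩(A ∣ 𝓖)`: the least number of pairwise intersections in a
sequence generating `A` from the generators `𝓖` by unions and intersections (Cavalar–Oliveira
2025, §2.1; for the star generators this is the star complexity with free unions of
Pudlák–Rödl–Savický 1988). **Junk value `0`** if `A` cannot be generated at all (e.g. `A` not
contained in the union of the generators); see `interDerivable_interCplx` for attainment. [cite: CavalarOliveira2025, §2.1] -/
noncomputable def interCplx (𝓖 : Set (Finset γ)) (A : Finset γ) : ℕ :=
  sInf {d | InterDerivable 𝓖 d A}

/-- A pool member is free over the pool. [cite: CavalarOliveira2025, Fact 4] -/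
theorem FreeOver.of_mem {𝓕 : Set (Finset γ)} {A : Finset γ} (h : A ∈ 𝓕) : FreeOver 𝓕 A :=
  ⟨{A}, by simpa using h, by simp⟩

/-- The empty set is free over every pool (empty union; cf. Cavalar–Oliveira 2025, Fact 8). [cite: CavalarOliveira2025, Fact 8] -/
theorem freeOver_empty (𝓕 : Set (Finset γ)) : FreeOver 𝓕 ∅ :=
  ⟨∅, by simp, by simp⟩

/-- Freeness is monotone in the pool. [folklore] -/
theorem FreeOver.mono {𝓕 𝓕' : Set (Finset γ)} (h : 𝓕 ⊆ 𝓕') {A : Finset γ} (hA : FreeOver 𝓕 A) :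
    FreeOver 𝓕' A := by
  obtain ⟨𝒪, h𝒪, rfl⟩ := hA
  exact ⟨𝒪, h𝒪.trans h, rfl⟩

/-- A union of two free sets is free (unions cost nothing). [cite: CavalarOliveira2025, §2.1] -/
theorem FreeOver.union {𝓕 : Set (Finset γ)} {A B : Finset γ} (hA : FreeOver 𝓕 A)
    (hB : FreeOver 𝓕 B) : FreeOver 𝓕 (A ∪ B) := by
  obtain ⟨𝒪, h𝒪, rfl⟩ := hA
  obtain ⟨𝒪', h𝒪', rfl⟩ := hB
  refine ⟨𝒪 ∪ 𝒪', ?_, ?_⟩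
  · rw [Finset.coe_union]
    exact Set.union_subset h𝒪 h𝒪'
  · rw [Finset.sup_union]
    rfl

/-- A finite union of free sets is free. [cite: CavalarOliveira2025, §2.1] -/
theorem FreeOver.finsetSup {𝓕 : Set (Finset γ)} {κ : Type*} (s : Finset κ) (f : κ → Finset γ)
    (h : ∀ k ∈ s, FreeOver 𝓕 (f k)) : FreeOver 𝓕 (s.sup f) := by
  induction s using Finset.cons_induction with
  | empty => simpa using freeOver_empty 𝓕
  | cons a s ha ih =>
    rw [Finset.sup_cons]
    exact (h a (Finset.mem_cons_self a s)).union
      (ih fun k hk => h k (Finset.mem_cons_of_mem hk))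

/-- Transitivity of freeness: a union of sets each of which is a union of `𝓖`-members is a union
of `𝓖`-members. [folklore] -/
theorem FreeOver.trans {𝓖 𝓟 : Set (Finset γ)} {A : Finset γ} (hA : FreeOver 𝓟 A)
    (h : ∀ P ∈ 𝓟, FreeOver 𝓖 P) : FreeOver 𝓖 A := by
  obtain ⟨𝒪, h𝒪, rfl⟩ := hA
  exact FreeOver.finsetSup 𝒪 id fun P hP => h P (h𝒪 hP)

/-- Intersection steps only enlarge the pool. [folklore] -/
theorem Reach.subset : ∀ {d : ℕ} {𝓖 𝓕 : Set (Finset γ)}, Reach d 𝓖 𝓕 → 𝓖 ⊆ 𝓕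
  | 0, _, _, h => by subst h; exact le_rfl
  | _ + 1, _, _, ⟨_, _, _, _, h⟩ => (Set.subset_insert _ _).trans (Reach.subset h)

/-- Appending one intersection step at the END of a derivation (the recursion in `Reach` peels
steps from the front). [folklore] -/
theorem Reach.snoc : ∀ {d : ℕ} {𝓖 𝓕 : Set (Finset γ)} {A B : Finset γ}, Reach d 𝓖 𝓕 →
    FreeOver 𝓕 A → FreeOver 𝓕 B → Reach (d + 1) 𝓖 (insert (A ∩ B) 𝓕)
  | 0, _, _, _, _, h, hA, hB => by subst h; exact ⟨_, _, hA, hB, rfl⟩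
  | _ + 1, _, _, _, _, ⟨A', B', hA', hB', h⟩, hA, hB => ⟨A', B', hA', hB', Reach.snoc h hA hB⟩

/-- Padding: a derivation can be prolonged by useless steps (`∅ ∩ ∅`), the pool only growing. [folklore] -/
theorem Reach.pad {d : ℕ} {𝓖 𝓕 : Set (Finset γ)} (h : Reach d 𝓖 𝓕) :
    ∀ j : ℕ, ∃ 𝓕' : Set (Finset γ), 𝓕 ⊆ 𝓕' ∧ Reach (d + j) 𝓖 𝓕'
  | 0 => ⟨𝓕, le_rfl, h⟩
  | j + 1 => by
    obtain ⟨𝓕', h𝓕', hR⟩ := Reach.pad h j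
    exact ⟨insert (∅ ∩ ∅) 𝓕', h𝓕'.trans (Set.subset_insert _ _),
      hR.snoc (freeOver_empty _) (freeOver_empty _)⟩

/-- With no intersections, exactly the free sets are derivable. [cite: CavalarOliveira2025, Fact 4] -/
theorem interDerivable_zero_iff {𝓖 : Set (Finset γ)} {A : Finset γ} :
    InterDerivable 𝓖 0 A ↔ FreeOver 𝓖 A := by
  constructor
  · rintro ⟨𝓕, h, hA⟩
    cases h
    exact hA
  · exact fun hA => ⟨𝓖, rfl, hA⟩

/-- `D_∩(A ∣ 𝓖) ≤ d` is monotone in `d`. [folklore] -/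
theorem InterDerivable.mono {𝓖 : Set (Finset γ)} {A : Finset γ} {d d' : ℕ} (h : InterDerivable 𝓖 d A)
    (hd : d ≤ d') : InterDerivable 𝓖 d' A := by
  obtain ⟨𝓕, hR, hA⟩ := h
  obtain ⟨j, rfl⟩ := Nat.exists_eq_add_of_le hd
  obtain ⟨𝓕', h𝓕', hR'⟩ := hR.pad j
  exact ⟨𝓕', hR', hA.mono h𝓕'⟩

/-- One more intersection of two derivable-pool-free sets: if after `d` steps the pool `𝓕` makes
`A` and `B` free, then `A ∩ B` (indeed anything free over `insert (A ∩ B) 𝓕`) is derivable in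
`d + 1` steps. [cite: CavalarOliveira2025, Fact 6] -/
theorem interDerivable_succ_of_reach {𝓖 𝓕 : Set (Finset γ)} {d : ℕ} {A B C : Finset γ}
    (hR : Reach d 𝓖 𝓕) (hA : FreeOver 𝓕 A) (hB : FreeOver 𝓕 B)
    (hC : FreeOver (insert (A ∩ B) 𝓕) C) : InterDerivable 𝓖 (d + 1) C :=
  ⟨_, hR.snoc hA hB, hC⟩

/-- Any derivation bounds the intersection complexity from above. [cite: CavalarOliveira2025, §2.1] -/
theorem interCplx_le_of_interDerivable {𝓖 : Set (Finset γ)} {A : Finset γ} {d : ℕ}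
    (h : InterDerivable 𝓖 d A) : interCplx 𝓖 A ≤ d :=
  Nat.sInf_le h

/-- If `A` is derivable at all, the infimum `interCplx 𝓖 A` is attained. [cite: CavalarOliveira2025, §2.1] -/
theorem interDerivable_interCplx {𝓖 : Set (Finset γ)} {A : Finset γ} {d : ℕ}
    (h : InterDerivable 𝓖 d A) : InterDerivable 𝓖 (interCplx 𝓖 A) A :=
  Nat.sInf_mem (⟨d, h⟩ : {d | InterDerivable 𝓖 d A}.Nonempty)

/-- Lower bounds: if `A` is derivable at all and not derivable with fewer than `d` intersections,
then `d ≤ D_∩(A ∣ 𝓖)`. [cite: CavalarOliveira2025, §2.1] -/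
theorem le_interCplx_of_forall_lt {𝓖 : Set (Finset γ)} {A : Finset γ} {d e : ℕ}
    (hex : InterDerivable 𝓖 e A) (h : ∀ d' < d, ¬ InterDerivable 𝓖 d' A) : d ≤ interCplx 𝓖 A := by
  by_contra hlt
  exact h _ (lt_of_not_ge hlt) (interDerivable_interCplx hex)

end Discrete

/-! ### Star complexity of bipartite graphs -/

section Stars

variable {α β : Type*} [DecidableEq α] [DecidableEq β]

/-- The row star `{x} × Y` of the bipartite ground set `X × Y` (Pudlák–Rödl–Savický 1988, §1;
Cavalar–Oliveira 2025, §2.2.2, the set `R_x`). [cite: PudlakRodlSavicky1988, §1] -/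
def rowStar (Y : Finset β) (x : α) : Finset (α × β) := {x} ×ˢ Y

/-- The column star `X × {y}` (Pudlák–Rödl–Savický 1988, §1; Cavalar–Oliveira 2025, §2.2.2, the
set `C_y`). [cite: PudlakRodlSavicky1988, §1] -/
def colStar (X : Finset α) (y : β) : Finset (α × β) := X ×ˢ {y}

/-- The star generators `𝒢_{X,Y} = {R_x : x ∈ X} ∪ {C_y : y ∈ Y}` of bipartite graph complexity on
the ground set `X × Y` (Pudlák–Rödl–Savický 1988, §1; Cavalar–Oliveira 2025, §2.2.2). [cite: CavalarOliveira2025, §2.2.2] -/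
def stars (X : Finset α) (Y : Finset β) : Set (Finset (α × β)) :=
  {S | ∃ x ∈ X, S = rowStar Y x} ∪ {S | ∃ y ∈ Y, S = colStar X y}

/-- The **star (intersection) complexity** `D_∩(G ∣ 𝒢_{X,Y})` of a bipartite graph `G ⊆ X × Y`:
the least number of intersections needed to generate the edge set `G` from row and column stars,
unions being free (Pudlák–Rödl–Savický 1988, §1 "star complexity"; Cavalar–Oliveira 2025, §1.2 and
§2.2.2 "intersection complexity of graphs"). Junk value `0` unless `G ⊆ X ×ˢ Y`
(`starCplx_le_card`). [cite: PudlakRodlSavicky1988, §1] -/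
noncomputable def starCplx (X : Finset α) (Y : Finset β) (G : Finset (α × β)) : ℕ :=
  interCplx (stars X Y) G

omit [DecidableEq α] [DecidableEq β] in
/-- Row stars are generators. [cite: CavalarOliveira2025, §2.2.2] -/
theorem rowStar_mem_stars {X : Finset α} (Y : Finset β) {x : α} (hx : x ∈ X) :
    rowStar Y x ∈ stars X Y :=
  Or.inl ⟨x, hx, rfl⟩

omit [DecidableEq α] [DecidableEq β] in
/-- Column stars are generators. [cite: CavalarOliveira2025, §2.2.2] -/
theorem colStar_mem_stars (X : Finset α) {Y : Finset β} {y : β} (hy : y ∈ Y) :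
    colStar X y ∈ stars X Y :=
  Or.inr ⟨y, hy, rfl⟩

/-- A row star meets a column star in one cell. [folklore] -/
theorem rowStar_inter_colStar {X : Finset α} {Y : Finset β} {x : α} {y : β} (hx : x ∈ X)
    (hy : y ∈ Y) : rowStar Y x ∩ colStar X y = {(x, y)} := by
  ext ⟨a, b⟩
  simp only [rowStar, colStar, Finset.mem_inter, Finset.mem_product, Finset.mem_singleton,
    Prod.mk.injEq]
  constructor
  · rintro ⟨⟨rfl, -⟩, -, rfl⟩
    exact ⟨rfl, rfl⟩
  · rintro ⟨rfl, rfl⟩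
    exact ⟨⟨rfl, hy⟩, hx, rfl⟩

/-- Every `G ⊆ X × Y` is generated with at most `#G` intersections (one cell `R_x ∩ C_y` per edge);
in particular the infimum defining `starCplx X Y G` is attained (cf. Cavalar–Oliveira 2025,
§2.2.2: `D_∩(G ∣ 𝒢_{N,M}) ≤ min {N, M}` by the finer row-by-row construction). [cite: CavalarOliveira2025, §2.2.2] -/
theorem interDerivable_stars_card {X : Finset α} {Y : Finset β} {G : Finset (α × β)}
    (hG : G ⊆ X ×ˢ Y) : InterDerivable (stars X Y) G.card G := by
  induction G using Finset.induction_on with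
  | empty => simpa using (interDerivable_zero_iff.2 (freeOver_empty _))
  | insert p G hp ih =>
    obtain ⟨x, y⟩ := p
    have hxy : (x, y) ∈ X ×ˢ Y := hG (Finset.mem_insert_self _ _)
    rw [Finset.mem_product] at hxy
    obtain ⟨𝓕, hR, hF⟩ := ih ((Finset.subset_insert _ _).trans hG)
    rw [Finset.card_insert_of_notMem hp]
    refine interDerivable_succ_of_reach hR
      ((FreeOver.of_mem (rowStar_mem_stars Y hxy.1)).mono hR.subset)
      ((FreeOver.of_mem (colStar_mem_stars X hxy.2)).mono hR.subset) ?_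
    rw [rowStar_inter_colStar hxy.1 hxy.2, Finset.insert_eq]
    exact (FreeOver.of_mem (Set.mem_insert _ _)).union (hF.mono (Set.subset_insert _ _))

/-- `D_∩(G ∣ 𝒢_{X,Y}) ≤ #G` for `G ⊆ X × Y`. [cite: CavalarOliveira2025, §2.2.2] -/
theorem starCplx_le_card {X : Finset α} {Y : Finset β} {G : Finset (α × β)} (hG : G ⊆ X ×ˢ Y) :
    starCplx X Y G ≤ G.card :=
  interCplx_le_of_interDerivable (interDerivable_stars_card hG)

/-- For `G ⊆ X × Y` the star complexity is attained by an actual derivation. [cite: CavalarOliveira2025, §2.2.2] -/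
theorem interDerivable_starCplx {X : Finset α} {Y : Finset β} {G : Finset (α × β)}
    (hG : G ⊆ X ×ˢ Y) : InterDerivable (stars X Y) (starCplx X Y G) G :=
  interDerivable_interCplx (interDerivable_stars_card hG)

/-- **Bipartite `K`-Ramsey graphs.** `G ⊆ X × Y` has no monochromatic `K × K` combinatorial
rectangle: for all `S ⊆ X`, `T ⊆ Y` with `#S = #T = K`, the rectangle `S × T` is neither
contained in `G` (all edges) nor disjoint from `G` (all non-edges). Equivalently the adjacency
function is a two-source disperser for min-entropy `log₂ K` (Jukna 2012, §1.7 and §11.6,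
bipartite Ramsey graphs; Pudlák–Rödl–Savický 1988). Degenerate cases: no graph is `0`- or
`1`-Ramsey on a non-empty grid. [cite: Jukna2012, §1.7] -/
def IsBipRamsey (X : Finset α) (Y : Finset β) (K : ℕ) (G : Finset (α × β)) : Prop :=
  ∀ ⦃S : Finset α⦄, S ⊆ X → ∀ ⦃T : Finset β⦄, T ⊆ Y → S.card = K → T.card = K →
    ¬ (S ×ˢ T ⊆ G) ∧ ¬ Disjoint (S ×ˢ T) G

end Stars

/-! ### Slices of a language as bipartite graphs -/

open scoped Classical in
/-- The `2n`-th slice of a language `L ⊆ {0,1}*` read as a bipartite graph on `{0,1}ⁿ × {0,1}ⁿ`: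
`(x, y)` is an edge iff the word `x ++ y` is in `L`. These are the graphs `G` whose associated
Boolean function `f_G(x, y)` (Cavalar–Oliveira 2025, §1.2 and Lemma 13, with `[N] ≃ {0,1}ⁿ` via
binary expansion) is a slice of `L`; an explicit family of graphs is one whose adjacency language
is easy. [cite: CavalarOliveira2025, §2.4 Lemma 13] -/
noncomputable def bipSlice (L : Language Bool) (n : ℕ) : Finset ((Fin n → Bool) × (Fin n → Bool)) :=
  Finset.univ.filter fun p => List.ofFn p.1 ++ List.ofFn p.2 ∈ L

/-- Membership in `bipSlice`. [cite: CavalarOliveira2025, §2.4] -/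
theorem mem_bipSlice {L : Language Bool} {n : ℕ} {p : (Fin n → Bool) × (Fin n → Bool)} :
    p ∈ bipSlice L n ↔ List.ofFn p.1 ++ List.ofFn p.2 ∈ L := by
  classical
  simp [bipSlice]

end Literature.Computability.Complexity.GraphComplexity
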